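import Summits.BirchSwinnertonDyer.Rank1Residual.X11a.ClassClosureRamTwistWitness
import HarnessLib

/-!
# Class X11a, class-closure N7: the T-BCRAM atom as a FINITE check over the prime divisors of the
# denominator of `j(E)` (cell `b2b-bsdres`, unit `b2b-bsdres-x11a`, gen 24)

HONEST FRAMING (run/shared/lean/b2b/bsd-rank1-residual/, verbatim in every file): the goal of the
cell is to DELETE the COMBINATION-SHAPED residual classes of the Birch–Swinnerton-Dyer formula for
ALL analytic-rank `≤ 1` elliptic curves over `ℚ` — "full BSD formula for every rank `≤ 1` curve in
class `C`" assembled STRICTLY from published theorems — so that the rank-`≤ 1` remainder becomes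
exactly the CONSTRUCTION-SHAPED classes, which are TYPED (missing-input `Prop`s), NOT attempted.
This is not "finishing BSD". Research route; NO CLAIM BEYOND STATED CLASSES. Theorems only; no
definition, no named fact; nothing booked; no label change.

WHAT. `X11a/ClassClosureRamTwistWitness.lean` (this unit, gen 24) proved
`RamOverQuadraticTwistAt W p ↔ ∃ q prime, q ≠ p, ord_q j(E) < 0, p ∤ ord_q j(E)`. This file makes
the right-hand side VISIBLY FINITE AND DECIDABLE from the reduced fraction `j(E) = num/den`:
for a prime `q`, `ord_q j < 0 ⟺ q ∣ den` and then `ord_q j = −ord_q den`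
(`padicValRat_neg_iff_prime_dvd_den`, `padicValRat_eq_neg_of_prime_dvd_den`; `gcd(num, den) = 1`),
so the `j`-witnesses are exactly the `q ∈ primeFactors(den)`, `q ≠ p`, with `p ∤ ord_q den`
(`jWitness_iff_exists_mem_primeFactors`), and
`ramOverQuadraticTwistAt_iff_exists_mem_primeFactors` states the census atom as that bounded
existential — the form in which an instrument (obsanat, HOME/class-closure/N7/) evaluates it from
Cremona's `j`. Elementary; nothing here is new mathematics.

References: HOME/class-closure/N7/SUBPARTITION.md (column T-BCRAM); HOME/b2b-bsdres-x11a/REPORT-g24.md.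
-/

noncomputable section

open scoped Classical

open WeierstrassCurve Literature.NumberTheory.EllipticCurves
  Literature.NumberTheory.EllipticCurves.Rank1Residual

set_option autoImplicit false

namespace Summit.BirchSwinnertonDyer.Rank1Residual.X11a

/-- For a prime `q` and a rational `j = num/den` in lowest terms: `ord_q j < 0` iff `q ∣ den`
(`ord_q j = ord_q num − ord_q den` and `gcd(num, den) = 1`). [folklore] -/
theorem padicValRat_neg_iff_prime_dvd_den {q : ℕ} [hq : Fact q.Prime] (j : ℚ) :
    padicValRat q j < 0 ↔ q ∣ j.den := by
  have hden : j.den ≠ 0 := j.den_nz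
  constructor
  · intro h
    by_contra hnd
    have h0 : padicValNat q j.den = 0 := padicValNat.eq_zero_of_not_dvd hnd
    rw [padicValRat_def, h0] at h
    have hnn : (0 : ℤ) ≤ (padicValInt q j.num : ℤ) := by positivity
    omega
  · intro hdvd
    have hnum : ¬ (q : ℤ) ∣ j.num := by
      intro h
      have h1 : q ∣ j.num.natAbs := Int.natCast_dvd.mp h
      have hg : q ∣ Nat.gcd j.num.natAbs j.den := Nat.dvd_gcd h1 hdvd
      rw [Nat.Coprime.gcd_eq_one j.reduced] at hg
      exact hq.out.one_lt.ne' (Nat.dvd_one.mp hg)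
    have h0 : padicValInt q j.num = 0 := padicValInt.eq_zero_of_not_dvd hnum
    have h1 : 1 ≤ padicValNat q j.den := one_le_padicValNat_of_dvd hden hdvd
    rw [padicValRat_def, h0]
    omega

/-- For a prime `q` dividing the denominator of `j`: `ord_q j = −ord_q den(j)`. [folklore] -/
theorem padicValRat_eq_neg_of_prime_dvd_den {q : ℕ} [hq : Fact q.Prime] (j : ℚ) (hdvd : q ∣ j.den) :
    padicValRat q j = -(padicValNat q j.den : ℤ) := by
  have hnum : ¬ (q : ℤ) ∣ j.num := by
    intro h
    have h1 : q ∣ j.num.natAbs := Int.natCast_dvd.mp h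
    have hg : q ∣ Nat.gcd j.num.natAbs j.den := Nat.dvd_gcd h1 hdvd
    rw [Nat.Coprime.gcd_eq_one j.reduced] at hg
    exact hq.out.one_lt.ne' (Nat.dvd_one.mp hg)
  rw [padicValRat_def, padicValInt.eq_zero_of_not_dvd hnum]
  simp

/-- **The `j`-witnesses are the prime divisors `q ≠ p` of `den(j)` with `p ∤ ord_q den(j)`** — a
bounded, decidable existential over `primeFactors(den(j))`. [folklore] -/
theorem jWitness_iff_exists_mem_primeFactors (j : ℚ) (p : ℕ) :
    (∃ q : ℕ, q.Prime ∧ q ≠ p ∧ padicValRat q j < 0 ∧ ¬ (p : ℤ) ∣ padicValRat q j) ↔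
      ∃ q ∈ j.den.primeFactors, q ≠ p ∧ ¬ p ∣ padicValNat q j.den := by
  have hden : j.den ≠ 0 := j.den_nz
  constructor
  · rintro ⟨q, hq, hqp, hneg, hndvd⟩
    haveI : Fact q.Prime := ⟨hq⟩
    have hdvd : q ∣ j.den := (padicValRat_neg_iff_prime_dvd_den j).mp hneg
    refine ⟨q, Nat.mem_primeFactors.mpr ⟨hq, hdvd, hden⟩, hqp, fun h => hndvd ?_⟩
    rw [padicValRat_eq_neg_of_prime_dvd_den j hdvd, dvd_neg]
    exact_mod_cast h
  · rintro ⟨q, hmem, hqp, hndvd⟩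
    obtain ⟨hq, hdvd, -⟩ := Nat.mem_primeFactors.mp hmem
    haveI : Fact q.Prime := ⟨hq⟩
    refine ⟨q, hq, hqp, (padicValRat_neg_iff_prime_dvd_den j).mpr hdvd, fun h => hndvd ?_⟩
    rw [padicValRat_eq_neg_of_prime_dvd_den j hdvd, dvd_neg] at h
    exact_mod_cast h

variable (W : WeierstrassCurve ℚ) [W.IsElliptic] (p : ℕ) [Fact p.Prime]

/-- **The T-BCRAM census atom as a finite check on `j(E) = num/den`**: some twist of `E` with
`p ∤ d` has a globally minimal model with a (ram) prime for `p` iff some prime divisor `q ≠ p` of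
`den(j(E))` has `p ∤ ord_q den(j(E))` (= `−ord_q j(E)` = `ord_q Δ_min` of the `q`-multiplicative
twist). This is the form the instrument evaluates from Cremona's `j`-invariant.
[cite: SilvermanAEC2009, VII.5 Prop. 5.1(b)] [cite: Silverman1994, V.5.3] -/
theorem ramOverQuadraticTwistAt_iff_exists_mem_primeFactors :
    RamOverQuadraticTwistAt W p ↔
      ∃ q ∈ W.j.den.primeFactors, q ≠ p ∧ ¬ p ∣ padicValNat q W.j.den := by
  rw [ramOverQuadraticTwistAt_iff_jWitness, jWitness_iff_exists_mem_primeFactors]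

/-- **Potentially good everywhere off `p` ⇒ no T-BCRAM atom**: if `den(j(E))` is a power of `p`
(every prime `q ≠ p` has `ord_q j(E) ≥ 0`, i.e. `E` is potentially good at every `q ≠ p`), then no
twist of `E` acquires a (ram) prime for `p`. [folklore] -/
theorem not_ramOverQuadraticTwistAt_of_den_eq_pow {k : ℕ} (hden : W.j.den = p ^ k) :
    ¬ RamOverQuadraticTwistAt W p := by
  rw [ramOverQuadraticTwistAt_iff_exists_mem_primeFactors]
  rintro ⟨q, hmem, hqp, -⟩
  obtain ⟨hq, hdvd, -⟩ := Nat.mem_primeFactors.mp hmem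
  rw [hden] at hdvd
  exact hqp ((Nat.prime_dvd_prime_iff_eq hq (Fact.out : p.Prime)).mp (hq.dvd_of_dvd_pow hdvd))

end Summit.BirchSwinnertonDyer.Rank1Residual.X11a

end
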